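import Summits.Ventures.HodgeRepro.TwistedQuadSegAllMArith

/-!
# Route-2's Theorem S, `M` form, for EVERY `k ≡ 4 (mod 8)` — one kernel theorem

Blind re-derivation cell `pub-hodge-repro`, seat `p1` (gen 12).  The `M` form of Theorem S (ROUTE-B §9.17; `k = 4`
on `M₁₆` in `TwistedQuad16`, `k = 12` in `TwistedQuadK8K12`) is the segment `{1, v, v², w}` with `w = v^{j+1} u`
for `v` of order `4j`, `v^{2j} = c`, `u v u⁻¹ = v^{2j+1} = c v` (so `w² = v^{2j+2} = c v²`, `w v w⁻¹ = c v`), on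
`TwistedQuadAllPos`'s model `ℤ/4j ⋊_{2j+1} ℤ/2`.  The family is again 8-periodic: `f₀(n) = [n mod 8 ∈ {2, 4, 5, 7}]`
on `⟨v⟩` (as in the `SD` form) and `f₁(n) = [(n − j + 1) mod 8 < 4]` on the `u`-coset — the coset pattern is the
`SD` one shifted by `j − 1`, which is why the decided `k = 4` and `k = 12` witnesses looked different (`j ≡ 2` vs
`j ≡ 6 (mod 8)`); verified `k = 4, 12, 20, 28, 36, 44` by enumeration (`segfamily_m.py`) and proved here for every
`j ≡ 2 (mod 4)`: `exists_segmentQuad_M_all`.  The inverse of `w` is `v^{j−1} u` (`(2j+1)(j−1) + (j+1) = 2j² ≡ 0`).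
-/

set_option autoImplicit false

open Finset Multiplicative
open scoped Pointwise

namespace HodgeRepro.TwistedQuadGen

open HodgeRepro.CosetQuad

variable {G : Type*} [Group G]

/-- The segment `{1, v, v², v^{j+1} u}` on a model group (the `M` form, `w = v^{j+1} u`). -/
def segMj (m : ℕ) [NeZero m] (s : ZMod m) (hs : s * s = 1) (j : ℕ) : Fin 4 → TwistGroup m s hs :=
  ![1, tv m s hs, tv m s hs ^ 2, tv m s hs ^ (j + 1) * tu m s hs]

/-- The twists `![1, v, v², v^{j+1} u]` are the images of `segMj`. -/
theorem modelHom_segMj (m : ℕ) [NeZero m] {s : ZMod m} {hs : s * s = 1} (hm : 1 < m) (j : ℕ) (v u : G)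
    (hv : v ^ m = 1) (hu : u ^ 2 = 1) (huv : u * v * u⁻¹ = v ^ s.val) (i : Fin 4) :
    modelHom m (hs := hs) v u hv hu huv (segMj m s hs j i) = ![1, v, v ^ 2, v ^ (j + 1) * u] i := by
  fin_cases i
  · exact map_one _
  · exact modelHom_tv m hm v u hv hu huv
  · show modelHom m (hs := hs) v u hv hu huv (tv m s hs ^ 2) = v ^ 2
    rw [map_pow, modelHom_tv m hm]
  · show modelHom m (hs := hs) v u hv hu huv (tv m s hs ^ (j + 1) * tu m s hs) = v ^ (j + 1) * u
    rw [map_mul, map_pow, modelHom_tv m hm, modelHom_tu]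

variable (j : ℕ) [NeZero j]

/-! ### Value arithmetic in `ℤ/4j` -/

/-- `(a + n).val` for a natural `n < 4j`. -/
theorem val_add_natCast (a : ZMod (4 * j)) (n : ℕ) (hn : n < 4 * j) :
    (a + ((n : ℕ) : ZMod (4 * j))).val = if a.val + n < 4 * j then a.val + n else a.val + n - 4 * j := by
  obtain ⟨i, hi, rfl⟩ := exists_natCast_eq j a
  rw [← Nat.cast_add, val_natCast_lt _ hi]
  split_ifs with h
  · exact val_natCast_lt _ h
  · rw [val_natCast_sub _ (by omega) (by omega)]

/-- `(a + n).val = a.val + n` when there is no wrap-around. -/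
theorem val_add_natCast_of_lt (a : ZMod (4 * j)) (n : ℕ) (h : a.val + n < 4 * j) :
    (a + ((n : ℕ) : ZMod (4 * j))).val = a.val + n := by
  rw [val_add_natCast j a n (by omega), if_pos h]

/-- `(a + n).val = a.val + n − 4j` when it wraps around. -/
theorem val_add_natCast_of_ge (a : ZMod (4 * j)) (n : ℕ) (hn : n < 4 * j) (h : 4 * j ≤ a.val + n) :
    (a + ((n : ℕ) : ZMod (4 * j))).val = a.val + n - 4 * j := by
  rw [val_add_natCast j a n hn, if_neg (by omega)]

omit [NeZero j] in
/-- `s · n = r` in `ℤ/4j` whenever `(2j + 1) n = q · 4j + r` in `ℕ`. -/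
theorem sPos_mul_natCast {n q r : ℕ} (h : (2 * j + 1) * n = q * (4 * j) + r) :
    sPos j * ((n : ℕ) : ZMod (4 * j)) = ((r : ℕ) : ZMod (4 * j)) := by
  rw [sPos, ← Nat.cast_mul, h, Nat.cast_add, Nat.cast_mul, four_j_cast, mul_zero, zero_add]

omit [NeZero j] in
/-- `((4j + r : ℕ) : ℤ/4j) = r`. -/
theorem natCast_four_j_add (r : ℕ) : ((4 * j + r : ℕ) : ZMod (4 * j)) = ((r : ℕ) : ZMod (4 * j)) := by
  rw [Nat.cast_add, four_j_cast, zero_add]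

/-! ### The segment and its inverses in coordinates -/

/-- `w = v^{j+1} u = mk (j + 1) 1`. -/
theorem segMj_three_eq :
    segMj (4 * j) (sPos j) (sPos_sq j) j 3 = mk (4 * j) (sPos j) (sPos_sq j) ((j + 1 : ℕ) : ZMod (4 * j)) 1 := by
  show tv (4 * j) (sPos j) (sPos_sq j) ^ (j + 1) * tu (4 * j) (sPos j) (sPos_sq j) =
    mk (4 * j) (sPos j) (sPos_sq j) ((j + 1 : ℕ) : ZMod (4 * j)) 1
  rw [tv_pow, tu_eq_mk, mk_mul, ZMod.val_zero, pow_zero, one_mul, add_zero, zero_add]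

/-- The inverses of `1, v, v², w`: `mk 0 0, mk (4j − 1) 0, mk (4j − 2) 0, mk (j − 1) 1` (`j` even). -/
theorem segMj_inv (hj : j % 4 = 2) :
    (segMj (4 * j) (sPos j) (sPos_sq j) j 0)⁻¹ = mk (4 * j) (sPos j) (sPos_sq j) 0 0 ∧
    (segMj (4 * j) (sPos j) (sPos_sq j) j 1)⁻¹ = mk (4 * j) (sPos j) (sPos_sq j) ((4 * j - 1 : ℕ) : ZMod (4 * j)) 0 ∧
    (segMj (4 * j) (sPos j) (sPos_sq j) j 2)⁻¹ = mk (4 * j) (sPos j) (sPos_sq j) ((4 * j - 2 : ℕ) : ZMod (4 * j)) 0 ∧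
    (segMj (4 * j) (sPos j) (sPos_sq j) j 3)⁻¹ = mk (4 * j) (sPos j) (sPos_sq j) ((j - 1 : ℕ) : ZMod (4 * j)) 1 := by
  refine ⟨?_, ?_, ?_, ?_⟩
  · show (1 : TwistGroup (4 * j) (sPos j) (sPos_sq j))⁻¹ = mk (4 * j) (sPos j) (sPos_sq j) 0 0
    rw [inv_one, one_eq_mk]
  · show (tv (4 * j) (sPos j) (sPos_sq j))⁻¹ = mk (4 * j) (sPos j) (sPos_sq j) ((4 * j - 1 : ℕ) : ZMod (4 * j)) 0
    rw [← pow_one (tv (4 * j) (sPos j) (sPos_sq j)), tv_pow]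
    apply inv_eq_of_mul_eq_one_right
    rw [mk_mul, ZMod.val_zero, pow_zero, one_mul, add_zero, ← Nat.cast_add, show 1 + (4 * j - 1) = 4 * j + 0 by omega,
      natCast_four_j_add, Nat.cast_zero, one_eq_mk]
  · show (tv (4 * j) (sPos j) (sPos_sq j) ^ 2)⁻¹ = mk (4 * j) (sPos j) (sPos_sq j) ((4 * j - 2 : ℕ) : ZMod (4 * j)) 0
    rw [tv_pow]
    apply inv_eq_of_mul_eq_one_right
    rw [mk_mul, ZMod.val_zero, pow_zero, one_mul, add_zero, ← Nat.cast_add, show 2 + (4 * j - 2) = 4 * j + 0 by omega,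
      natCast_four_j_add, Nat.cast_zero, one_eq_mk]
  · rw [segMj_three_eq]
    apply inv_eq_of_mul_eq_one_right
    obtain ⟨q, hq⟩ : ∃ q, j = 4 * q + 2 := ⟨j / 4, by omega⟩
    have hid : (2 * j + 1) * (j - 1) = (2 * q) * (4 * j) + (3 * j - 1) := by
      subst hq
      rw [show 4 * q + 2 - 1 = 4 * q + 1 by omega, show 3 * (4 * q + 2) - 1 = 12 * q + 5 by omega]; ring
    rw [mk_mul, val_one_two, pow_one, sPos_mul_natCast _ hid, two_zmod_two, ← Nat.cast_add,
      show j + 1 + (3 * j - 1) = 4 * j + 0 by omega, natCast_four_j_add, Nat.cast_zero, one_eq_mk]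

/-- The four neighbours of a `⟨v⟩`-point: `mk a 0, mk (a + (4j−1)) 0, mk (a + (4j−2)) 0, mk (a + (j−1)) 1`. -/
theorem segM_nbrs_zero (hj : j % 4 = 2) (a : ZMod (4 * j)) :
    mk (4 * j) (sPos j) (sPos_sq j) a 0 * (segMj (4 * j) (sPos j) (sPos_sq j) j 0)⁻¹ =
      mk (4 * j) (sPos j) (sPos_sq j) a 0 ∧
    mk (4 * j) (sPos j) (sPos_sq j) a 0 * (segMj (4 * j) (sPos j) (sPos_sq j) j 1)⁻¹ =
      mk (4 * j) (sPos j) (sPos_sq j) (a + ((4 * j - 1 : ℕ) : ZMod (4 * j))) 0 ∧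
    mk (4 * j) (sPos j) (sPos_sq j) a 0 * (segMj (4 * j) (sPos j) (sPos_sq j) j 2)⁻¹ =
      mk (4 * j) (sPos j) (sPos_sq j) (a + ((4 * j - 2 : ℕ) : ZMod (4 * j))) 0 ∧
    mk (4 * j) (sPos j) (sPos_sq j) a 0 * (segMj (4 * j) (sPos j) (sPos_sq j) j 3)⁻¹ =
      mk (4 * j) (sPos j) (sPos_sq j) (a + ((j - 1 : ℕ) : ZMod (4 * j))) 1 := by
  obtain ⟨i0, i1, i2, i3⟩ := segMj_inv j hj
  refine ⟨?_, ?_, ?_, ?_⟩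
  · rw [i0, mk_mul, ZMod.val_zero, pow_zero, one_mul, add_zero, add_zero]
  · rw [i1, mk_mul, ZMod.val_zero, pow_zero, one_mul, add_zero]
  · rw [i2, mk_mul, ZMod.val_zero, pow_zero, one_mul, add_zero]
  · rw [i3, mk_mul, ZMod.val_zero, pow_zero, one_mul, zero_add]

/-- The four neighbours of a `u`-coset point: `mk a 1, mk (a + (2j−1)) 1, mk (a + (4j−2)) 1, mk (a + (3j−1)) 0`. -/
theorem segM_nbrs_one (hj : j % 4 = 2) (a : ZMod (4 * j)) :
    mk (4 * j) (sPos j) (sPos_sq j) a 1 * (segMj (4 * j) (sPos j) (sPos_sq j) j 0)⁻¹ =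
      mk (4 * j) (sPos j) (sPos_sq j) a 1 ∧
    mk (4 * j) (sPos j) (sPos_sq j) a 1 * (segMj (4 * j) (sPos j) (sPos_sq j) j 1)⁻¹ =
      mk (4 * j) (sPos j) (sPos_sq j) (a + ((2 * j - 1 : ℕ) : ZMod (4 * j))) 1 ∧
    mk (4 * j) (sPos j) (sPos_sq j) a 1 * (segMj (4 * j) (sPos j) (sPos_sq j) j 2)⁻¹ =
      mk (4 * j) (sPos j) (sPos_sq j) (a + ((4 * j - 2 : ℕ) : ZMod (4 * j))) 1 ∧
    mk (4 * j) (sPos j) (sPos_sq j) a 1 * (segMj (4 * j) (sPos j) (sPos_sq j) j 3)⁻¹ =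
      mk (4 * j) (sPos j) (sPos_sq j) (a + ((3 * j - 1 : ℕ) : ZMod (4 * j))) 0 := by
  obtain ⟨i0, i1, i2, i3⟩ := segMj_inv j hj
  obtain ⟨q, hq⟩ : ∃ q, j = 4 * q + 2 := ⟨j / 4, by omega⟩
  have e1 : (2 * j + 1) * (4 * j - 1) = (2 * j) * (4 * j) + (2 * j - 1) := by
    subst hq
    rw [show 4 * (4 * q + 2) - 1 = 16 * q + 7 by omega, show 2 * (4 * q + 2) - 1 = 8 * q + 3 by omega]; ring
  have e2 : (2 * j + 1) * (4 * j - 2) = (2 * j - 1) * (4 * j) + (4 * j - 2) := by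
    subst hq
    rw [show 4 * (4 * q + 2) - 2 = 16 * q + 6 by omega, show 2 * (4 * q + 2) - 1 = 8 * q + 3 by omega]; ring
  have e3 : (2 * j + 1) * (j - 1) = (2 * q) * (4 * j) + (3 * j - 1) := by
    subst hq
    rw [show 4 * q + 2 - 1 = 4 * q + 1 by omega, show 3 * (4 * q + 2) - 1 = 12 * q + 5 by omega]; ring
  refine ⟨?_, ?_, ?_, ?_⟩
  · rw [i0, mk_mul, val_one_two, pow_one, mul_zero, add_zero, add_zero]
  · rw [i1, mk_mul, val_one_two, pow_one, sPos_mul_natCast _ e1, add_zero]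
  · rw [i2, mk_mul, val_one_two, pow_one, sPos_mul_natCast _ e2, add_zero]
  · rw [i3, mk_mul, val_one_two, pow_one, sPos_mul_natCast _ e3, two_zmod_two]

/-! ### The pattern -/

/-- The pattern on the model. -/
def segPatM (p : TwistGroup (4 * j) (sPos j) (sPos_sq j)) : Prop :=
  (p.right = ofAdd 0 ∧ seg0 (toAdd p.left).val) ∨ (p.right = ofAdd 1 ∧ seg1M j (toAdd p.left).val)

/-- The predicate `segPatM j` is decidable. -/
instance : DecidablePred (segPatM j) := fun p => by unfold segPatM; infer_instance

/-- The CM type of the model. -/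
def ΦM : Finset (TwistGroup (4 * j) (sPos j) (sPos_sq j)) := univ.filter (segPatM j)

/-- Membership on the `⟨v⟩`-layer. -/
theorem mem_ΦM_zero (a : ZMod (4 * j)) : mk (4 * j) (sPos j) (sPos_sq j) a 0 ∈ ΦM j ↔ seg0 a.val := by
  rw [ΦM, Finset.mem_filter]
  have h01 : (ofAdd (0 : ZMod 2) : Multiplicative (ZMod 2)) ≠ ofAdd 1 := by decide
  simp only [Finset.mem_univ, true_and, segPatM, mk, toAdd_ofAdd, h01, false_and, or_false]

/-- Membership on the `u`-coset. -/
theorem mem_ΦM_one (a : ZMod (4 * j)) : mk (4 * j) (sPos j) (sPos_sq j) a 1 ∈ ΦM j ↔ seg1M j a.val := by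
  rw [ΦM, Finset.mem_filter]
  have h10 : (ofAdd (1 : ZMod 2) : Multiplicative (ZMod 2)) ≠ ofAdd 0 := by decide
  simp only [Finset.mem_univ, true_and, segPatM, mk, toAdd_ofAdd, h10, false_and, false_or]

/-! ### The three local conditions (`j ≡ 2 (mod 4)`) -/

/-- CM: `p c ∈ Φ ↔ p ∉ Φ`. -/
theorem segM_cm (hj : j % 4 = 2) (p : TwistGroup (4 * j) (sPos j) (sPos_sq j)) :
    p * tc (4 * j) (sPos j) (sPos_sq j) ∈ ΦM j ↔ ¬ p ∈ ΦM j := by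
  obtain ⟨l, r⟩ := p
  obtain ⟨a, rfl⟩ := ofAdd.surjective l
  obtain ⟨g, rfl⟩ := ofAdd.surjective r
  show mk (4 * j) (sPos j) (sPos_sq j) a g * tc (4 * j) (sPos j) (sPos_sq j) ∈ ΦM j ↔
    ¬ mk (4 * j) (sPos j) (sPos_sq j) a g ∈ ΦM j
  rw [mk_mul_tc_pos]
  have hv : a.val < 4 * j := ZMod.val_lt a
  have hh := val_add_half j a
  rcases (show ∀ y : ZMod 2, y = 0 ∨ y = 1 by decide) g with rfl | rfl
  · rw [mem_ΦM_zero, mem_ΦM_zero, hh]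
    unfold seg0
    split_ifs <;> omega
  · rw [mem_ΦM_one, mem_ΦM_one, hh]
    unfold seg1M
    split_ifs <;> omega

/-- SumTwo: exactly two of the four neighbours of every point lie in `Φ`. -/
theorem segM_sumTwo (hj : j % 4 = 2) (p : TwistGroup (4 * j) (sPos j) (sPos_sq j)) :
    (univ.filter fun i : Fin 4 => p * (segMj (4 * j) (sPos j) (sPos_sq j) j i)⁻¹ ∈ ΦM j).card = 2 := by
  obtain ⟨l, r⟩ := p
  obtain ⟨a, rfl⟩ := ofAdd.surjective l
  obtain ⟨g, rfl⟩ := ofAdd.surjective r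
  have e : (⟨ofAdd a, ofAdd g⟩ : TwistGroup (4 * j) (sPos j) (sPos_sq j)) = mk (4 * j) (sPos j) (sPos_sq j) a g := rfl
  rw [e, Finset.card_filter, Fin.sum_univ_four]
  have hv : a.val < 4 * j := ZMod.val_lt a
  rcases (show ∀ y : ZMod 2, y = 0 ∨ y = 1 by decide) g with rfl | rfl
  · obtain ⟨n0, n1, n2, n3⟩ := segM_nbrs_zero j hj a
    simp only [n0, n1, n2, n3, mem_ΦM_zero, mem_ΦM_one]
    rcases (show a.val = 0 ∨ a.val = 1 ∨ (2 ≤ a.val ∧ a.val < 3 * j + 1) ∨ 3 * j + 1 ≤ a.val by omega) with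
      ha | ha | ⟨ha, ha'⟩ | ha
    · rw [val_add_natCast_of_lt j a (4 * j - 1) (by omega), val_add_natCast_of_lt j a (4 * j - 2) (by omega),
        val_add_natCast_of_lt j a (j - 1) (by omega), ha]
      exact segM_sum_zero_0 j hj
    · rw [val_add_natCast_of_ge j a (4 * j - 1) (by omega) (by omega), val_add_natCast_of_lt j a (4 * j - 2) (by omega),
        val_add_natCast_of_lt j a (j - 1) (by omega), ha]
      exact segM_sum_zero_1 j hj
    · have k1 : (a + ((4 * j - 1 : ℕ) : ZMod (4 * j))).val = a.val - 1 := by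
        rw [val_add_natCast_of_ge j a (4 * j - 1) (by omega) (by omega)]; omega
      have k2 : (a + ((4 * j - 2 : ℕ) : ZMod (4 * j))).val = a.val - 2 := by
        rw [val_add_natCast_of_ge j a (4 * j - 2) (by omega) (by omega)]; omega
      rw [k1, k2, val_add_natCast_of_lt j a (j - 1) (by omega)]
      exact segM_sum_zero_mid j hj a.val ha ha'
    · have k1 : (a + ((4 * j - 1 : ℕ) : ZMod (4 * j))).val = a.val - 1 := by
        rw [val_add_natCast_of_ge j a (4 * j - 1) (by omega) (by omega)]; omega
      have k2 : (a + ((4 * j - 2 : ℕ) : ZMod (4 * j))).val = a.val - 2 := by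
        rw [val_add_natCast_of_ge j a (4 * j - 2) (by omega) (by omega)]; omega
      rw [k1, k2, val_add_natCast_of_ge j a (j - 1) (by omega) (by omega)]
      exact segM_sum_zero_hi j hj a.val ha hv
  · obtain ⟨n0, n1, n2, n3⟩ := segM_nbrs_one j hj a
    simp only [n0, n1, n2, n3, mem_ΦM_zero, mem_ΦM_one]
    rcases (show a.val = 0 ∨ a.val = 1 ∨ (2 ≤ a.val ∧ a.val ≤ j) ∨ (j < a.val ∧ a.val ≤ 2 * j) ∨ 2 * j < a.val
        by omega) with ha | ha | ⟨ha, ha'⟩ | ⟨ha, ha'⟩ | ha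
    · rw [val_add_natCast_of_lt j a (2 * j - 1) (by omega), val_add_natCast_of_lt j a (4 * j - 2) (by omega),
        val_add_natCast_of_lt j a (3 * j - 1) (by omega), ha]
      exact segM_sum_one_0 j hj
    · rw [val_add_natCast_of_lt j a (2 * j - 1) (by omega), val_add_natCast_of_lt j a (4 * j - 2) (by omega),
        val_add_natCast_of_lt j a (3 * j - 1) (by omega), ha]
      exact segM_sum_one_1 j hj
    · have k2 : (a + ((4 * j - 2 : ℕ) : ZMod (4 * j))).val = a.val - 2 := by
        rw [val_add_natCast_of_ge j a (4 * j - 2) (by omega) (by omega)]; omega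
      rw [val_add_natCast_of_lt j a (2 * j - 1) (by omega), k2, val_add_natCast_of_lt j a (3 * j - 1) (by omega)]
      exact segM_sum_one_B j hj a.val ha ha'
    · have k2 : (a + ((4 * j - 2 : ℕ) : ZMod (4 * j))).val = a.val - 2 := by
        rw [val_add_natCast_of_ge j a (4 * j - 2) (by omega) (by omega)]; omega
      rw [val_add_natCast_of_lt j a (2 * j - 1) (by omega), k2,
        val_add_natCast_of_ge j a (3 * j - 1) (by omega) (by omega)]
      exact segM_sum_one_C j hj a.val ha ha'
    · have k2 : (a + ((4 * j - 2 : ℕ) : ZMod (4 * j))).val = a.val - 2 := by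
        rw [val_add_natCast_of_ge j a (4 * j - 2) (by omega) (by omega)]; omega
      rw [val_add_natCast_of_ge j a (2 * j - 1) (by omega) (by omega), k2,
        val_add_natCast_of_ge j a (3 * j - 1) (by omega) (by omega)]
      exact segM_sum_one_D j hj a.val ha hv

/-- The neighbour memberships of a `⟨v⟩`-point, as predicates. -/
def segMkM (i : Fin 4) (a : ZMod (4 * j)) : Prop :=
  match i with
  | 0 => seg0 a.val
  | 1 => seg0 (a + ((4 * j - 1 : ℕ) : ZMod (4 * j))).val
  | 2 => seg0 (a + ((4 * j - 2 : ℕ) : ZMod (4 * j))).val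
  | 3 => seg1M j (a + ((j - 1 : ℕ) : ZMod (4 * j))).val

/-- `segM_nbrs_zero` as memberships. -/
theorem segM_mem_nbr (hj : j % 4 = 2) (a : ZMod (4 * j)) (i : Fin 4) :
    mk (4 * j) (sPos j) (sPos_sq j) a 0 * (segMj (4 * j) (sPos j) (sPos_sq j) j i)⁻¹ ∈ ΦM j ↔ segMkM j i a := by
  obtain ⟨n0, n1, n2, n3⟩ := segM_nbrs_zero j hj a
  have hfin : ∀ x : Fin 4, x = 0 ∨ x = 1 ∨ x = 2 ∨ x = 3 := by decide
  rcases hfin i with rfl | rfl | rfl | rfl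
  · rw [n0, mem_ΦM_zero]; exact Iff.rfl
  · rw [n1, mem_ΦM_zero]; exact Iff.rfl
  · rw [n2, mem_ΦM_zero]; exact Iff.rfl
  · rw [n3, mem_ΦM_one]; exact Iff.rfl

/-- A `⟨v⟩`-point where the memberships `Φ t_k`, `Φ t_i` AGREE refutes the conjugate pair `(i, k)`. -/
theorem segM_sep_of (hj : j % 4 = 2) (a : ZMod (4 * j)) (i k : Fin 4) (h : segMkM j k a ↔ segMkM j i a) :
    ¬ ∀ q : TwistGroup (4 * j) (sPos j) (sPos_sq j),
      (q * (segMj (4 * j) (sPos j) (sPos_sq j) j k)⁻¹ ∈ ΦM j ↔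
        q * (tc (4 * j) (sPos j) (sPos_sq j) * (segMj (4 * j) (sPos j) (sPos_sq j) j i)⁻¹) ∈ ΦM j) := by
  intro hall
  have hc : ∀ q : TwistGroup (4 * j) (sPos j) (sPos_sq j),
      q * (tc (4 * j) (sPos j) (sPos_sq j) * (segMj (4 * j) (sPos j) (sPos_sq j) j i)⁻¹) =
        (q * (segMj (4 * j) (sPos j) (sPos_sq j) j i)⁻¹) * tc (4 * j) (sPos j) (sPos_sq j) := by
    intro q
    rw [← mul_assoc, mul_assoc q, (isComplexConj_tc_gen j (by omega) _ _ (sPos_mul_half j)).comm, ← mul_assoc]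
  have := hall (mk (4 * j) (sPos j) (sPos_sq j) a 0)
  rw [hc, segM_cm j hj, segM_mem_nbr j hj, segM_mem_nbr j hj] at this
  by_cases hi : segMkM j i a
  · exact (this.mp (h.mpr hi)) hi
  · exact hi (h.mp (this.mpr hi))

/-- No conjugate pair: one of the points `1, v, v², v⁵` has equal memberships `Φ t_k`, `Φ t_i`. -/
theorem segM_noConj (hj : j % 4 = 2) (i k : Fin 4) :
    ¬ ∀ q : TwistGroup (4 * j) (sPos j) (sPos_sq j),
      (q * (segMj (4 * j) (sPos j) (sPos_sq j) j k)⁻¹ ∈ ΦM j ↔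
        q * (tc (4 * j) (sPos j) (sPos_sq j) * (segMj (4 * j) (sPos j) (sPos_sq j) j i)⁻¹) ∈ ΦM j) := by
  have hfin : ∀ x : Fin 4, x = 0 ∨ x = 1 ∨ x = 2 ∨ x = 3 := by decide
  have h0 : (0 : ZMod (4 * j)).val = 0 := ZMod.val_zero
  have h1 : ((1 : ℕ) : ZMod (4 * j)).val = 1 := val_natCast_lt _ (by omega)
  have h2 : ((2 : ℕ) : ZMod (4 * j)).val = 2 := val_natCast_lt _ (by omega)
  have h5 : ((5 : ℕ) : ZMod (4 * j)).val = 5 := val_natCast_lt _ (by omega)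
  -- memberships at the points 0, 1, 2, 5: (F,T,F,T), (F,F,T,T), (T,F,F,T), (T,T,F,F)
  have w0 : ¬ segMkM j 0 0 ∧ segMkM j 1 0 ∧ ¬ segMkM j 2 0 ∧ segMkM j 3 0 := by
    simp only [segMkM]; unfold seg0 seg1M
    rw [val_add_natCast_of_lt j (0 : ZMod (4 * j)) (4 * j - 1) (by rw [h0]; omega),
      val_add_natCast_of_lt j (0 : ZMod (4 * j)) (4 * j - 2) (by rw [h0]; omega),
      val_add_natCast_of_lt j (0 : ZMod (4 * j)) (j - 1) (by rw [h0]; omega), h0]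
    omega
  have w1 : ¬ segMkM j 0 ((1 : ℕ) : ZMod (4 * j)) ∧ ¬ segMkM j 1 ((1 : ℕ) : ZMod (4 * j)) ∧
      segMkM j 2 ((1 : ℕ) : ZMod (4 * j)) ∧ segMkM j 3 ((1 : ℕ) : ZMod (4 * j)) := by
    simp only [segMkM]; unfold seg0 seg1M
    rw [val_add_natCast_of_ge j ((1 : ℕ) : ZMod (4 * j)) (4 * j - 1) (by omega) (by rw [h1]; omega),
      val_add_natCast_of_lt j ((1 : ℕ) : ZMod (4 * j)) (4 * j - 2) (by rw [h1]; omega),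
      val_add_natCast_of_lt j ((1 : ℕ) : ZMod (4 * j)) (j - 1) (by rw [h1]; omega), h1]
    omega
  have w2 : segMkM j 0 ((2 : ℕ) : ZMod (4 * j)) ∧ ¬ segMkM j 1 ((2 : ℕ) : ZMod (4 * j)) ∧
      ¬ segMkM j 2 ((2 : ℕ) : ZMod (4 * j)) ∧ segMkM j 3 ((2 : ℕ) : ZMod (4 * j)) := by
    simp only [segMkM]; unfold seg0 seg1M
    rw [val_add_natCast_of_ge j ((2 : ℕ) : ZMod (4 * j)) (4 * j - 1) (by omega) (by rw [h2]; omega),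
      val_add_natCast_of_ge j ((2 : ℕ) : ZMod (4 * j)) (4 * j - 2) (by omega) (by rw [h2]; omega),
      val_add_natCast_of_lt j ((2 : ℕ) : ZMod (4 * j)) (j - 1) (by rw [h2]; omega), h2]
    omega
  have w5 : segMkM j 0 ((5 : ℕ) : ZMod (4 * j)) ∧ segMkM j 1 ((5 : ℕ) : ZMod (4 * j)) ∧
      ¬ segMkM j 2 ((5 : ℕ) : ZMod (4 * j)) ∧ ¬ segMkM j 3 ((5 : ℕ) : ZMod (4 * j)) := by
    simp only [segMkM]; unfold seg0 seg1M
    rw [val_add_natCast_of_ge j ((5 : ℕ) : ZMod (4 * j)) (4 * j - 1) (by omega) (by rw [h5]; omega),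
      val_add_natCast_of_ge j ((5 : ℕ) : ZMod (4 * j)) (4 * j - 2) (by omega) (by rw [h5]; omega),
      val_add_natCast_of_lt j ((5 : ℕ) : ZMod (4 * j)) (j - 1) (by rw [h5]; omega), h5]
    omega
  obtain ⟨p0, p1, p2, p3⟩ := w0
  obtain ⟨q0, q1, q2, q3⟩ := w1
  obtain ⟨r0, r1, r2, r3⟩ := w2
  obtain ⟨t0, t1, t2, t3⟩ := w5
  rcases hfin i with rfl | rfl | rfl | rfl <;> rcases hfin k with rfl | rfl | rfl | rfl
  · exact segM_sep_of j hj 0 0 0 Iff.rfl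
  · exact segM_sep_of j hj _ 0 1 (iff_of_true t1 t0)
  · exact segM_sep_of j hj 0 0 2 (iff_of_false p2 p0)
  · exact segM_sep_of j hj _ 0 3 (iff_of_true r3 r0)
  · exact segM_sep_of j hj _ 1 0 (iff_of_true t0 t1)
  · exact segM_sep_of j hj 0 1 1 Iff.rfl
  · exact segM_sep_of j hj _ 1 2 (iff_of_false r2 r1)
  · exact segM_sep_of j hj 0 1 3 (iff_of_true p3 p1)
  · exact segM_sep_of j hj 0 2 0 (iff_of_false p0 p2)
  · exact segM_sep_of j hj _ 2 1 (iff_of_false r1 r2)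
  · exact segM_sep_of j hj 0 2 2 Iff.rfl
  · exact segM_sep_of j hj _ 2 3 (iff_of_true q3 q2)
  · exact segM_sep_of j hj _ 3 0 (iff_of_true r0 r3)
  · exact segM_sep_of j hj 0 3 1 (iff_of_true p1 p3)
  · exact segM_sep_of j hj _ 3 2 (iff_of_true q2 q3)
  · exact segM_sep_of j hj 0 3 3 Iff.rfl

/-! ### The theorem -/

/-- **Theorem S, `M` form, for EVERY `k = 2j ≡ 4 (mod 8)` (route-2 §9.17; kernel existence).**  For every finite
`(G, c)`, `v` of order `4j` with `v^{2j} = c` and an involution `u ∉ ⟨v⟩` with `u v u⁻¹ = v^{2j+1}` (`= c v`): some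
CM type has the twisted segment `Φ, Φv, Φv², Φw`, `w = v^{j+1} u`, `SumTwo` without a conjugate pair. -/
theorem exists_segmentQuad_M_all [Fintype G] [DecidableEq G] (hj : j % 4 = 2) {c : G}
    (hc : IsComplexConj c) (v u : G) (hv : orderOf v = 4 * j) (hu : u ^ 2 = 1)
    (huv : u * v * u⁻¹ = v ^ (2 * j + 1)) (hnot : u ∉ Subgroup.zpowers v) (hcj : v ^ (2 * j) = c) :
    ∃ Φ : Finset G, IsCMType c Φ ∧ SumTwo (fun i => rmul Φ (![1, v, v ^ 2, v ^ (j + 1) * u] i)) ∧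
      ∀ i k : Fin 4, rmul Φ (![1, v, v ^ 2, v ^ (j + 1) * u] k) ≠ c • rmul Φ (![1, v, v ^ 2, v ^ (j + 1) * u] i) := by
  have hvm : v ^ (4 * j) = 1 := by rw [← hv]; exact pow_orderOf_eq_one v
  have huv' : u * v * u⁻¹ = v ^ (sPos j).val := by rw [sPos_val j (by omega)]; exact huv
  obtain ⟨Φ, g1, g2, g3⟩ := exists_quad_of_model (4 * j) (modelHom (4 * j) (hs := sPos_sq j) v u hvm hu huv')
    (modelHom_injective (4 * j) v u hvm hu huv' hv hnot) hc
    (by rw [modelHom_tc, show 4 * j / 2 = 2 * j by omega]; exact hcj) (segMj (4 * j) (sPos j) (sPos_sq j) j) (ΦM j)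
    (fun p => (decide_eq_decide.mpr (segM_cm j hj p)).trans decide_not)
    (fun p => by simp only [decide_eq_true_eq]; exact segM_sumTwo j hj p)
    (fun i k h => segM_noConj j hj i k (fun p => by simpa only [decide_eq_true_eq] using h p))
  simp only [modelHom_segMj (4 * j) (by omega : 1 < 4 * j) j] at g2 g3
  exact ⟨Φ, g1, g2, g3⟩

end HodgeRepro.TwistedQuadGen
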